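import Summits.BirchSwinnertonDyer.Rank1Residual.AdditivePotMult.QuadraticBaseChangeDescentOverC
import Summits.BirchSwinnertonDyer.Rank1Residual.AdditivePotMult.TwistSupplyOddDiscr
import HarnessLib

/-!
# X3♯(M), ALL PAIRS, WITHOUT MILNE: additive-p1's uniform class theorems `bsdp_of_classX3M`,
# `bsdp_of_classX3M_of_forall_quadratic`, `missingPPartAt_of_classX3M` re-issued with
# `{hMilneC} ↦ ∅` (row T-MIL-UNI, FILE U-4b; seat n1011-p01 GEN 10)

HONEST FRAMING (cell `b2b-bsdres`, run/shared/lean/b2b/bsd-rank1-residual/, verbatim in every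
file): the goal of the cell is to DELETE the COMBINATION-SHAPED residual classes of the
Birch–Swinnerton-Dyer formula for ALL analytic-rank `≤ 1` elliptic curves over `ℚ` — "full BSD
formula for every rank `≤ 1` curve in class `C`" assembled STRICTLY from published theorems — so
that the rank-`≤ 1` remainder becomes exactly the CONSTRUCTION-SHAPED classes, which are TYPED
(missing-input `Prop`s), NOT attempted. This is not "finishing BSD". Sub-classes X3♯(M) / X4(M)
(additive, potentially multiplicative prime; base-change-and-descend): a RESEARCH ROUTE; they stay
CONSTRUCTION-SHAPED; nothing is booked by this file; no mark / label moved. THEOREMS ONLY: no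
definition, no named fact, no `sorry`.

## What (row T-MIL-UNI, `cells/n1011/skel/T-MIL-UNI.md`, FILE U-4b — the X3♯(M) twin of FILE U-4)

additive-p1's ALL-PAIRS relocation of X3♯(M) (`TwistSupply.bsdp_of_classX3M`,
`…_of_forall_quadratic`, `missingPPartAt_of_classX3M`) carries Milne's Weil-restriction identity as
the NAMED FACT `hMilneC : Milne1972.bsdQuotient_baseChange_quadratic_anyModel` (A73). This file
re-issues the three theorems with binder diff EXACTLY `{hMilneC} ↦ ∅`: the rank-zero
`p`-multiplicative twist WITH the Greenberg–Vatsal parity condition is taken over a quadratic field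
with ODD discriminant prime to the other additive primes —
`ClassX3M.exists_gvPar_rankZero_mult_twist_oddDiscr`: FILE U-3's supply core on the `p*`-twist model
`V` with the SIGN of the Hoffstein–Luo parameter `n ≡ 1 (mod 8)` chosen by the parity of `V`
(`GVPar V p`: `n > 0` keeps gvpar, tree `gvPar_twist_iff_of_pos`; `¬ GVPar V p`: `n < 0` creates it,
tree `gvPar_of_not_gvPar_of_twist` — Greenberg–Vatsal 2000, remark after Thm. 1.3), `d_K = p*·n` —,
on which FILE U-2's model-free Milne-free END descends and the twist is closed by the X2 owner's
sub-cell X2a (`bsdp_twist_of_rankZero_gvPar`: Greenberg–Vatsal 2000, Wuthrich 2014 Thm. 16,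
Stein–Wuthrich 2013, Greenberg–Stevens, GZK, modularity — the SAME binders as the original).

HONEST LIMITS: X3♯(M) stays CONSTRUCTION-SHAPED (`MissingPPartOverCAt` untouched); flag
`GV00-mult-asserted` of the original stands; analytic rank `≥ 2` not covered; closes no class; moves
no mark; 0 facts.

References: J. S. Milne, Invent. Math. 17 (1972) §1 Thm. 1 [Milne1972ArithmeticAV] (the fact
REMOVED); R. Greenberg, V. Vatsal, Invent. Math. 142 (2000) Thm. 1.3 [GreenbergVatsal2000];
C. Wuthrich, Doc. Math. 19 (2014) Thm. 16 [Wuthrich2014]; W. Stein, C. Wuthrich, Math. Comp. 82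
(2013) [SteinWuthrich2013]; J. Hoffstein, W. Luo, Math. Res. Lett. 4 (1997) [HoffsteinLuo1997].
-/

noncomputable section

open scoped Classical

open WeierstrassCurve Literature.NumberTheory.EllipticCurves
  Literature.NumberTheory.EllipticCurves.ModularForms
  Literature.NumberTheory.EllipticCurves.Rank1Residual
  Literature.NumberTheory.EllipticCurves.Rank1Residual.Typed
  Literature.NumberTheory.EllipticCurves.GreenbergVatsal2000
  Literature.NumberTheory.EllipticCurves.Wuthrich2014
  Literature.NumberTheory.EllipticCurves.SteinWuthrich2013
  IsDedekindDomain Rat.HeightOneSpectrum NumberField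

namespace Summit.BirchSwinnertonDyer.Rank1Residual.AdditivePotMult

section NoMilneX3

variable {W : WeierstrassCurve ℚ} [W.IsElliptic] {p : ℕ} [hp : Fact p.Prime]

/-- **X3♯(M): the rank-zero gvpar `p`-multiplicative twist over a quadratic field with ODD
discriminant prime to the other additive primes EXISTS** (modularity `hnf`, Hoffstein–Luo 1997
`hHL`): `K`, a globally minimal `W_d` with `C_d • W^{(d_K)} = W_d`, `d_K` odd squarefree, `p ∣ d_K`,
`Mult W_d p`, `GVPar W_d p`, `r_an(W_d) = 0`, and H-4b's population hypothesis for `(W, K, W_d)`.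
Proof: `V` the globally minimal `p*`-twist model (`C • V^{(p*)} = W`, multiplicative at `p`, `V[p]`
reducible); FILE U-3's core `exists_rankZero_mult_twist_oddDiscr_of_pStar_model` with sign `+1` if
`GVPar V p` (gvpar transports along the positive `p`-unramified twist `n`, `gvPar_twist_iff_of_pos`)
and sign `−1` otherwise (a negative `p`-unramified twist of a reducible non-gvpar curve is gvpar,
`gvPar_of_not_gvPar_of_twist`) — an existence proof that case-splits CLASSICALLY (`by_cases`) on the
undecided `GVPar V p`, exactly as additive-p1's `ClassX3M.exists_mult_gvPar_twist` does.
[cite: GreenbergVatsal2000, Thm. 1.3 and the remark following it]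
[cite: HoffsteinLuo1997, Theorem (§1, pp. 435–436)] -/
theorem ClassX3M.exists_gvPar_rankZero_mult_twist_oddDiscr [W.IsGloballyMinimal] (hX : ClassX3M W p)
    (hnf : exists_isNewformOf) (hHL : HoffsteinLuo1997_exists_twist_L_one_ne_zero) :
    ∃ (K : Type) (_ : Field K) (_ : NumberField K) (Wd : WeierstrassCurve ℚ) (_ : Wd.IsElliptic)
      (_ : Wd.IsGloballyMinimal) (Cd : VariableChange ℚ), Module.finrank ℚ K = 2 ∧
      Odd (NumberField.discr K) ∧ Squarefree (NumberField.discr K) ∧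
      (p : ℤ) ∣ NumberField.discr K ∧
      Cd • W.quadraticTwist (NumberField.discr K : ℚ) = Wd ∧ Mult Wd p ∧ GVPar Wd p ∧
      Wd.analyticRank = 0 ∧
      (∀ v : HeightOneSpectrum (𝓞 ℚ), W.HasGoodReductionAt v ∨ W.HasMultiplicativeReductionAt v ∨
        (((primesEquiv v : ℕ) : ℤ) ∣ NumberField.discr K ∧ Wd.HasMultiplicativeReductionAt v) ∨
        (W.HasAdditiveReductionAt v ∧ ¬ ((primesEquiv v : ℕ) : ℤ) ∣ NumberField.discr K ∧
          (p = 3 → (primesEquiv v : ℕ) ≠ 3))) := by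
  have hp2 : p ≠ 2 := ClassX3M.p_ne_two W p hX
  have hps0 : ((-1 : ℚ) ^ (p / 2) * p) ≠ 0 := Additive.pStar_ne_zero p
  obtain ⟨V, iV, iVm, C, hmultV, hCV⟩ := hX.exists_mult_pStar_twist_model
  -- `V` is a model of `W^{(p*)}`: `V[p]` is reducible
  obtain ⟨C', hC'⟩ := exists_variableChange_smul_eq_of_smul_quadraticTwist_eq V W hps0 hCV
  have hredV : Red V p := red_of_model_twist hps0 ⟨C', hC'.symm⟩ hX.1.1
  by_cases hgv : GVPar V p
  · obtain ⟨K, iF, iN, Wd, iWd, iWdm, Cd, C₂, n, h2, hnsign, hpn, hC₂, hodd, hsq, hpd, hWd, hmult, hr0,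
      hadd, -⟩ :=
      exists_rankZero_mult_twist_oddDiscr_of_pStar_model (W := W) (p := p) hnf hHL hp2 V C hmultV hCV
        (s := 1) (Or.inl rfl)
    have hn0 : 0 < n := Int.sign_eq_one_iff_pos.mp hnsign
    have hC₂' : C₂⁻¹ • Wd = V.quadraticTwist ((n : ℤ) : ℚ) := by rw [← hC₂, inv_smul_smul]
    have hgvd : GVPar Wd p := (gvPar_twist_iff_of_pos hp2 hn0 hpn C₂⁻¹ hC₂').mpr hgv
    exact ⟨K, iF, iN, Wd, iWd, iWdm, Cd, h2, hodd, hsq, hpd, hWd, hmult, hgvd, hr0,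
      localHyp_of_oddDiscr W Wd p hpd hmult hadd⟩
  · obtain ⟨K, iF, iN, Wd, iWd, iWdm, Cd, C₂, n, h2, hnsign, hpn, hC₂, hodd, hsq, hpd, hWd, hmult, hr0,
      hadd, -⟩ :=
      exists_rankZero_mult_twist_oddDiscr_of_pStar_model (W := W) (p := p) hnf hHL hp2 V C hmultV hCV
        (s := -1) (Or.inr rfl)
    have hn0 : n < 0 := Int.sign_eq_neg_one_iff_neg.mp hnsign
    have hC₂' : C₂⁻¹ • Wd = V.quadraticTwist ((n : ℤ) : ℚ) := by rw [← hC₂, inv_smul_smul]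
    have hgvd : GVPar Wd p := gvPar_of_not_gvPar_of_twist hp2 hredV hgv hn0 hpn Wd C₂⁻¹ hC₂'
    exact ⟨K, iF, iN, Wd, iWd, iWdm, Cd, h2, hodd, hsq, hpd, hWd, hmult, hgvd, hr0,
      localHyp_of_oddDiscr W Wd p hpd hmult hadd⟩

/-- **X3♯(M) ⇐ the over-`K` input over quadratic fields — for EVERY pair, WITHOUT MILNE.** Let
`(E,p) ∈ X3♯(M)` (`W` globally minimal, `p` an odd additive Eisenstein prime with `ord_p j(E) < 0`)
have analytic rank `≤ 1`. Suppose the typed over-`K` input `MissingPPartOverCAt (W.baseChange K) p`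
holds for every quadratic field `K` whose twist `E^{(d_K)}` (globally minimal model `W_d`) is
multiplicative at `p`. Then `BSD(E,p)`. Inputs, all published and carried as named-fact binders
EXACTLY as in additive-p1's `TwistSupply.bsdp_of_classX3M` MINUS `hMilneC` (Milne 1972, A73):
Greenberg–Vatsal 2000 at a multiplicative prime (`hGV`, flag `GV00-mult-asserted`), Wuthrich 2014
Thm. 16 (`hWu`), Stein–Wuthrich 2013 (`hJs hJn hHs hHn`), Greenberg–Stevens (`hGS`), GZK (`hGZK`),
modularity (`hmod`, `hpar`, `hnf`), Hoffstein–Luo 1997 (`hHL`). The twist pair of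
`ClassX3M.exists_gvPar_rankZero_mult_twist_oddDiscr` is closed by the X2 owner's sub-cell X2a
(`bsdp_twist_of_rankZero_gvPar`), and FILE U-2's model-free Milne-free END descends. X3♯(M) stays
CONSTRUCTION-SHAPED. [cite: GreenbergVatsal2000, Thm. 1.3] [cite: Wuthrich2014, Thm. 16]
[cite: HoffsteinLuo1997, Theorem (§1, pp. 435–436)]
[cite: Milne1972ArithmeticAV, §1 Thm. 1 and §2 (through DokchitserDokchitserAnnals2010, §2.1, proof of Thm. 8)] -/
theorem bsdp_of_classX3M_noMilne [W.IsGloballyMinimal] (hGV : lambdaMu_multiplicative_of_gvPar)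
    (hWu : thm16_charIdeal_dvd_multiplicative_of_reducible)
    (hJs : thm61_splitMultiplicative) (hJn : thm61_nonsplitMultiplicative)
    (hHs : exists_isSplitMultCanonical) (hHn : exists_isMultCanonical)
    (hGZK : rank_eq_analyticRank_of_analyticRank_le_one) (hmod : hasEntireLFunction_rat)
    (hpar : nonempty_modularParametrizationData)
    (hnf : exists_isNewformOf) (hHL : HoffsteinLuo1997_exists_twist_L_one_ne_zero)
    (hGS : ∀ (V : WeierstrassCurve ℚ) [V.IsElliptic] [V.IsGloballyMinimal],
      greenberg_stevens (W := V) (p := p))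
    (hX : ClassX3M W p) (hr : W.analyticRank ≤ 1)
    (hK : ∀ (K : Type) [Field K] [NumberField K] (Wd : WeierstrassCurve ℚ) [Wd.IsElliptic]
      [Wd.IsGloballyMinimal], Module.finrank ℚ K = 2 →
      (∃ C : VariableChange ℚ, C • W.quadraticTwist (NumberField.discr K : ℚ) = Wd) →
      Mult Wd p → MissingPPartOverCAt (W.baseChange K) p) :
    BSDp W p := by
  obtain ⟨K, iF, iN, Wd, iWd, iWdm, Cd, h2, hodd, hsq, hpd, hWd, hmult, hgv, hr0, hS⟩ :=
    hX.exists_gvPar_rankZero_mult_twist_oddDiscr hnf hHL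
  have hD : (NumberField.discr K : ℚ) ≠ 0 := by exact_mod_cast NumberField.discr_ne_zero K
  obtain ⟨hp2, hred, -⟩ := classX2_twist_of_classX3M hX hD ⟨Cd, hWd⟩ hmult
  have hd : BSDp Wd p :=
    bsdp_twist_of_rankZero_gvPar p Wd hGV hWu hJs hJn hHs hHn hGZK hmod hpar (hGS Wd) hp2 hmult hred hgv
      hr0
  exact bsdp_of_pPartOverC_baseChange_of_bsdp_twist_noMilne_of_addv_unramified_oddPrime_of_dvd_discr W
    p K Wd hGZK hmod h2 hodd hsq hpd hWd hr (by rw [hr0]; exact zero_le_one) hp2 hmult hS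
    (hK K Wd h2 ⟨Cd, hWd⟩ hmult) hd

/-- **X3♯(M) ⇐ the `p`-part of BSD for `E` over every quadratic field, WITHOUT MILNE** (plainer
hypothesis; additive-p1's `bsdp_of_classX3M_of_forall_quadratic` minus `hMilneC`).
[cite: GreenbergVatsal2000, Thm. 1.3] [cite: Wuthrich2014, Thm. 16]
[cite: Milne1972ArithmeticAV, §1 Thm. 1 and §2 (through DokchitserDokchitserAnnals2010, §2.1, proof of Thm. 8)] -/
theorem bsdp_of_classX3M_of_forall_quadratic_noMilne [W.IsGloballyMinimal]
    (hGV : lambdaMu_multiplicative_of_gvPar)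
    (hWu : thm16_charIdeal_dvd_multiplicative_of_reducible)
    (hJs : thm61_splitMultiplicative) (hJn : thm61_nonsplitMultiplicative)
    (hHs : exists_isSplitMultCanonical) (hHn : exists_isMultCanonical)
    (hGZK : rank_eq_analyticRank_of_analyticRank_le_one) (hmod : hasEntireLFunction_rat)
    (hpar : nonempty_modularParametrizationData)
    (hnf : exists_isNewformOf) (hHL : HoffsteinLuo1997_exists_twist_L_one_ne_zero)
    (hGS : ∀ (V : WeierstrassCurve ℚ) [V.IsElliptic] [V.IsGloballyMinimal],
      greenberg_stevens (W := V) (p := p))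
    (hX : ClassX3M W p) (hr : W.analyticRank ≤ 1)
    (hK : ∀ (K : Type) [Field K] [NumberField K], Module.finrank ℚ K = 2 →
      MissingPPartOverCAt (W.baseChange K) p) :
    BSDp W p :=
  bsdp_of_classX3M_noMilne hGV hWu hJs hJn hHs hHn hGZK hmod hpar hnf hHL hGS hX hr
    fun K _ _ _ _ _ h2 _ _ ↦ hK K h2

/-- The uniform X3♯(M) theorem WITHOUT MILNE in the cell's `MissingPPartAt` currency (additive-p1's
`missingPPartAt_of_classX3M` minus `hMilneC`). [cite: GreenbergVatsal2000, Thm. 1.3]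
[cite: Wuthrich2014, Thm. 16]
[cite: Milne1972ArithmeticAV, §1 Thm. 1 and §2 (through DokchitserDokchitserAnnals2010, §2.1, proof of Thm. 8)] -/
theorem missingPPartAt_of_classX3M_noMilne [W.IsGloballyMinimal]
    (hGV : lambdaMu_multiplicative_of_gvPar)
    (hWu : thm16_charIdeal_dvd_multiplicative_of_reducible)
    (hJs : thm61_splitMultiplicative) (hJn : thm61_nonsplitMultiplicative)
    (hHs : exists_isSplitMultCanonical) (hHn : exists_isMultCanonical)
    (hGZK : rank_eq_analyticRank_of_analyticRank_le_one) (hmod : hasEntireLFunction_rat)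
    (hpar : nonempty_modularParametrizationData)
    (hnf : exists_isNewformOf) (hHL : HoffsteinLuo1997_exists_twist_L_one_ne_zero)
    (hGS : ∀ (V : WeierstrassCurve ℚ) [V.IsElliptic] [V.IsGloballyMinimal],
      greenberg_stevens (W := V) (p := p))
    (hX : ClassX3M W p) (hr : W.analyticRank ≤ 1)
    (hK : ∀ (K : Type) [Field K] [NumberField K] (Wd : WeierstrassCurve ℚ) [Wd.IsElliptic]
      [Wd.IsGloballyMinimal], Module.finrank ℚ K = 2 →
      (∃ C : VariableChange ℚ, C • W.quadraticTwist (NumberField.discr K : ℚ) = Wd) →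
      Mult Wd p → MissingPPartOverCAt (W.baseChange K) p) :
    MissingPPartAt W p := by
  haveI : Finite W.sha := (hGZK W hr).2
  exact missingPPartAt_of_bsdp W p
    (bsdp_of_classX3M_noMilne hGV hWu hJs hJn hHs hHn hGZK hmod hpar hnf hHL hGS hX hr hK)

end NoMilneX3

end Summit.BirchSwinnertonDyer.Rank1Residual.AdditivePotMult

end
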